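import Mathlib.Analysis.SpecialFunctions.ImproperIntegrals
import Mathlib.Analysis.SpecialFunctions.Integrals.Basic
import Mathlib.Analysis.Real.Pi.Bounds
import Mathlib.MeasureTheory.Integral.Bochner.Basic
import HarnessLib

/-!
# Route BECCutLineWeakDisorder — `WitnessTransfer`, occupation estimate at a coincidence point II:
# Green-function bounds for the speed-`4` heat kernel on `ℝ³`

Support file (does not close the item) for item stmt-AtomisticToContinuum-14978
(`Summit.AtomisticToContinuum.BoseEinsteinCondensation.Theses.BECCutLineWeakDisorder`, decl
`WitnessTransfer`), stub (S8) `stub_threeDim_occupation_pz` of line `Sketch`. Elementary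
one-variable estimates for the time integrals of the radial profile
`q_t(r) = (√(8πt))⁻³ e^{-r²/(8t)}` of the Gaussian `N(0, 4t I₃)` (the law of the pair difference
of two world-lines):

* `green_lower` — `∫_{(0,T]} q_t(r) dt ≥ e^{-1/4} / (2 √(8π)³) · r⁻¹` for `0 < r ≤ √T`
  (restrict to `t ∈ [r²/2, r²]`);
* `green_upper` — `∫_{(0,∞)} q_t(r) dt ≤ 4√8 / √(8π)³ · r⁻¹` for `r > 0` (on `t ≤ r²/8` use
  `e^{-x} ≤ 2/x²`, on `t ≥ r²/8` drop the exponential and integrate `t^{-3/2}`); the exact value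
  is `1/(8πr)`, not needed;
* `green_consts` — the numerical facts `e^{-1/4}/(2√(8π)³) ≥ 2/1000` and
  `4√8/√(8π)³ ≤ 125 · e^{-1/4}/(2√(8π)³)` (`π < 3.15`, `e^{-1/4} ≥ 3/4`).

## References

* K. L. Chung, Z. Zhao, *From Brownian Motion to Schrödinger's Equation* (1995), (1.11) and
  §3.3 (3.33). [ChungZhao1995]
-/

noncomputable section

open MeasureTheory Set Real
open scoped ENNReal NNReal

namespace Summit.AtomisticToContinuum.BoseEinsteinCondensation.Theorems.CutLineWitness

/-! ### The radial profile of `N(0, 4t I₃)` -/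

/-- Factorisation of the normalisation: `(√(8πt))⁻³ = (√(8π))⁻³ (√t)⁻³`. [folklore] -/
theorem inv_sqrt_eight_pi_mul_pow (t : ℝ) :
    (Real.sqrt (8 * Real.pi * t))⁻¹ ^ 3 = (Real.sqrt (8 * Real.pi))⁻¹ ^ 3 * (Real.sqrt t)⁻¹ ^ 3 := by
  rw [Real.sqrt_mul (by positivity), mul_inv, mul_pow]

/-- The radial profile is nonnegative. [folklore] -/
theorem heatProfile_nonneg (t r : ℝ) :
    0 ≤ (Real.sqrt (8 * Real.pi * t))⁻¹ ^ 3 * Real.exp (-r ^ 2 / (8 * t)) := by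
  positivity

/-- The radial profile is jointly measurable in `(t, r)`. [folklore] -/
theorem measurable_heatProfile :
    Measurable fun p : ℝ × ℝ => ENNReal.ofReal
      ((Real.sqrt (8 * Real.pi * p.1))⁻¹ ^ 3 * Real.exp (-p.2 ^ 2 / (8 * p.1))) := by
  refine ENNReal.measurable_ofReal.comp ?_
  refine Measurable.mul ?_ (Real.measurable_exp.comp ?_)
  · exact ((measurable_const.mul measurable_fst).sqrt.inv).pow_const 3
  · exact (measurable_snd.pow_const 2).neg.div (measurable_const.mul measurable_fst)

/-! ### Lower bound on `(0, T]` -/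

/-- **Green-function lower bound**: for `0 < r` with `r² ≤ T`,
`∫_{(0,T]} (√(8πt))⁻³ e^{-r²/(8t)} dt ≥ e^{-1/4}/(2√(8π)³) · r⁻¹`: on `t ∈ [r²/2, r²] ⊆ (0, T]` the
integrand is at least `(√(8π) r)⁻³ e^{-1/4}`, and the interval has length `r²/2`. [folklore] -/
theorem green_lower {T r : ℝ} (hr : 0 < r) (hrT : r ^ 2 ≤ T) :
    ENNReal.ofReal (Real.exp (-(1 / 4 : ℝ)) / (2 * Real.sqrt (8 * Real.pi) ^ 3) * r⁻¹) ≤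
      ∫⁻ t in Ioc 0 T, ENNReal.ofReal
        ((Real.sqrt (8 * Real.pi * t))⁻¹ ^ 3 * Real.exp (-r ^ 2 / (8 * t))) := by
  have hsπ : 0 < Real.sqrt (8 * Real.pi) := Real.sqrt_pos.2 (by positivity)
  set L : ℝ := (Real.sqrt (8 * Real.pi) * r)⁻¹ ^ 3 * Real.exp (-(1 / 4 : ℝ)) with hL
  have hL0 : 0 ≤ L := by positivity
  have hsub : Icc (r ^ 2 / 2) (r ^ 2) ⊆ Ioc 0 T := fun t ht =>
    ⟨lt_of_lt_of_le (by positivity) ht.1, ht.2.trans hrT⟩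
  have hpt : ∀ t ∈ Icc (r ^ 2 / 2) (r ^ 2),
      L ≤ (Real.sqrt (8 * Real.pi * t))⁻¹ ^ 3 * Real.exp (-r ^ 2 / (8 * t)) := by
    intro t ht
    have ht0 : 0 < t := lt_of_lt_of_le (by positivity) ht.1
    have h1 : (Real.sqrt (8 * Real.pi) * r)⁻¹ ≤ (Real.sqrt (8 * Real.pi * t))⁻¹ := by
      refine inv_anti₀ (Real.sqrt_pos.2 (by positivity)) ?_
      calc Real.sqrt (8 * Real.pi * t) ≤ Real.sqrt (8 * Real.pi * r ^ 2) :=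
            Real.sqrt_le_sqrt (by nlinarith [ht.2, Real.pi_pos])
        _ = Real.sqrt (8 * Real.pi) * r := by
            rw [Real.sqrt_mul (by positivity), Real.sqrt_sq hr.le]
    have h2 : Real.exp (-(1 / 4 : ℝ)) ≤ Real.exp (-r ^ 2 / (8 * t)) := by
      refine Real.exp_le_exp.2 ?_
      have h : r ^ 2 / (8 * t) ≤ 1 / 4 := by
        rw [div_le_iff₀ (by positivity)]
        nlinarith [ht.1]
      rw [neg_div]
      linarith
    rw [hL]
    exact mul_le_mul (pow_le_pow_left₀ (by positivity) h1 3) h2 (by positivity) (by positivity)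
  calc ENNReal.ofReal (Real.exp (-(1 / 4 : ℝ)) / (2 * Real.sqrt (8 * Real.pi) ^ 3) * r⁻¹)
      = ENNReal.ofReal L * volume (Icc (r ^ 2 / 2) (r ^ 2)) := by
        rw [Real.volume_Icc, ← ENNReal.ofReal_mul hL0]
        congr 1
        rw [hL]
        field_simp
        ring
    _ = ∫⁻ _ in Icc (r ^ 2 / 2) (r ^ 2), ENNReal.ofReal L := by rw [setLIntegral_const]
    _ ≤ ∫⁻ t in Icc (r ^ 2 / 2) (r ^ 2), ENNReal.ofReal
          ((Real.sqrt (8 * Real.pi * t))⁻¹ ^ 3 * Real.exp (-r ^ 2 / (8 * t))) :=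
        setLIntegral_mono' measurableSet_Icc fun t ht => ENNReal.ofReal_le_ofReal (hpt t ht)
    _ ≤ _ := lintegral_mono_set hsub

/-! ### Upper bound on `(0, ∞)` -/

/-- Small times: for `0 < t ≤ t₀`, `(√(8πt))⁻³ e^{-r²/(8t)} ≤ (√(8π))⁻³ · 128 √t₀ / r⁴`
(`e^{-x} ≤ 2/x²` with `x = r²/(8t)`). [folklore] -/
theorem heatProfile_le_small {r t t₀ : ℝ} (hr : 0 < r) (ht : 0 < t) (htt₀ : t ≤ t₀) :
    (Real.sqrt (8 * Real.pi * t))⁻¹ ^ 3 * Real.exp (-r ^ 2 / (8 * t)) ≤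
      (Real.sqrt (8 * Real.pi))⁻¹ ^ 3 * (128 * Real.sqrt t₀ / r ^ 4) := by
  rw [inv_sqrt_eight_pi_mul_pow, mul_assoc]
  refine mul_le_mul_of_nonneg_left ?_ (by positivity)
  have hx : 0 < r ^ 2 / (8 * t) := by positivity
  have hu2 : Real.sqrt t ^ 2 = t := Real.sq_sqrt ht.le
  set u : ℝ := Real.sqrt t with hu
  have hu0 : 0 < u := Real.sqrt_pos.2 ht
  calc u⁻¹ ^ 3 * Real.exp (-r ^ 2 / (8 * t))
      ≤ u⁻¹ ^ 3 * (2 / (r ^ 2 / (8 * t)) ^ 2) := by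
        refine mul_le_mul_of_nonneg_left ?_ (by positivity)
        -- `e^{-x} ≤ 2/x²` for `x = r²/(8t) > 0`, from `x²/2 ≤ e^x`
        have h := Real.pow_div_factorial_le_exp (r ^ 2 / (8 * t)) hx.le 2
        rw [Nat.factorial_two, Nat.cast_ofNat] at h
        rw [neg_div, Real.exp_neg]
        calc (Real.exp (r ^ 2 / (8 * t)))⁻¹ ≤ ((r ^ 2 / (8 * t)) ^ 2 / 2)⁻¹ :=
              inv_anti₀ (by positivity) h
          _ = 2 / (r ^ 2 / (8 * t)) ^ 2 := by rw [inv_div]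
    _ = 128 * u / r ^ 4 := by
        rw [← hu2]
        field_simp
        ring
    _ ≤ 128 * Real.sqrt t₀ / r ^ 4 := by
        rw [hu]
        gcongr

/-- Large times: for `t > 0`, `(√(8πt))⁻³ e^{-r²/(8t)} ≤ (√(8π))⁻³ t^{-3/2}`. [folklore] -/
theorem heatProfile_le_large (r : ℝ) {t : ℝ} (ht : 0 < t) :
    (Real.sqrt (8 * Real.pi * t))⁻¹ ^ 3 * Real.exp (-r ^ 2 / (8 * t)) ≤
      (Real.sqrt (8 * Real.pi))⁻¹ ^ 3 * t ^ (-(3 / 2 : ℝ)) := by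
  rw [inv_sqrt_eight_pi_mul_pow, mul_assoc]
  refine mul_le_mul_of_nonneg_left ?_ (by positivity)
  have hst : (Real.sqrt t)⁻¹ ^ 3 = t ^ (-(3 / 2 : ℝ)) := by
    rw [Real.sqrt_eq_rpow, ← Real.rpow_neg ht.le, ← Real.rpow_natCast,
      ← Real.rpow_mul ht.le]
    norm_num
  rw [← hst]
  refine mul_le_of_le_one_right (by positivity) ?_
  rw [Real.exp_le_one_iff, neg_div]
  exact neg_nonpos.2 (by positivity)

/-- **Green-function upper bound**: for `r > 0`,
`∫_{(0,∞)} (√(8πt))⁻³ e^{-r²/(8t)} dt ≤ 4√8/√(8π)³ · r⁻¹` (split at `t₀ = r²/8`: the small-time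
part is at most `(√(8π))⁻³ · 128 √t₀ t₀ / r⁴ = 2√8 (√(8π))⁻³/r`, the large-time part at most
`(√(8π))⁻³ ∫_{t₀}^∞ t^{-3/2} dt = 2√8 (√(8π))⁻³ / r`). The exact value is `1/(8πr)`.
[folklore] -/
theorem green_upper {r : ℝ} (hr : 0 < r) :
    ∫⁻ t in Ioi (0 : ℝ), ENNReal.ofReal
        ((Real.sqrt (8 * Real.pi * t))⁻¹ ^ 3 * Real.exp (-r ^ 2 / (8 * t))) ≤
      ENNReal.ofReal (4 * Real.sqrt 8 / Real.sqrt (8 * Real.pi) ^ 3 * r⁻¹) := by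
  set A : ℝ := (Real.sqrt (8 * Real.pi))⁻¹ ^ 3 with hA
  have hA0 : 0 ≤ A := by positivity
  set t₀ : ℝ := r ^ 2 / 8 with ht₀
  have ht₀0 : 0 < t₀ := by positivity
  have hsqt₀ : Real.sqrt t₀ = r / Real.sqrt 8 := by
    rw [ht₀, Real.sqrt_div' _ (by norm_num : (0 : ℝ) ≤ 8), Real.sqrt_sq hr.le]
  have hs8 : 0 < Real.sqrt 8 := Real.sqrt_pos.2 (by norm_num)
  have hs88 : Real.sqrt 8 * Real.sqrt 8 = 8 := Real.mul_self_sqrt (by norm_num)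
  -- small times
  have hsmall : ∫⁻ t in Ioc 0 t₀, ENNReal.ofReal
      ((Real.sqrt (8 * Real.pi * t))⁻¹ ^ 3 * Real.exp (-r ^ 2 / (8 * t))) ≤
      ENNReal.ofReal (A * (2 * Real.sqrt 8) * r⁻¹) := by
    calc ∫⁻ t in Ioc 0 t₀, ENNReal.ofReal
          ((Real.sqrt (8 * Real.pi * t))⁻¹ ^ 3 * Real.exp (-r ^ 2 / (8 * t)))
        ≤ ∫⁻ _ in Ioc 0 t₀, ENNReal.ofReal (A * (128 * Real.sqrt t₀ / r ^ 4)) :=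
          setLIntegral_mono' measurableSet_Ioc fun t ht =>
            ENNReal.ofReal_le_ofReal (heatProfile_le_small hr ht.1 ht.2)
      _ = ENNReal.ofReal (A * (128 * Real.sqrt t₀ / r ^ 4)) * volume (Ioc 0 t₀) :=
          setLIntegral_const _ _
      _ = ENNReal.ofReal (A * (2 * Real.sqrt 8) * r⁻¹) := by
          rw [Real.volume_Ioc, sub_zero, ← ENNReal.ofReal_mul (by positivity)]
          congr 1
          rw [hsqt₀, ht₀]
          field_simp
          nlinarith [hs88]
  -- large times
  have hlarge : ∫⁻ t in Ioi t₀, ENNReal.ofReal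
      ((Real.sqrt (8 * Real.pi * t))⁻¹ ^ 3 * Real.exp (-r ^ 2 / (8 * t))) ≤
      ENNReal.ofReal (A * (2 * Real.sqrt 8) * r⁻¹) := by
    have hint : IntegrableOn (fun t : ℝ => A * t ^ (-(3 / 2 : ℝ))) (Ioi t₀) :=
      (integrableOn_Ioi_rpow_of_lt (by norm_num) ht₀0).const_mul A
    have hnn : 0 ≤ᵐ[volume.restrict (Ioi t₀)] fun t : ℝ => A * t ^ (-(3 / 2 : ℝ)) := by
      refine (ae_restrict_iff' measurableSet_Ioi).2 (ae_of_all _ fun t ht => ?_)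
      exact mul_nonneg hA0 (Real.rpow_nonneg (ht₀0.trans ht).le _)
    calc ∫⁻ t in Ioi t₀, ENNReal.ofReal
          ((Real.sqrt (8 * Real.pi * t))⁻¹ ^ 3 * Real.exp (-r ^ 2 / (8 * t)))
        ≤ ∫⁻ t in Ioi t₀, ENNReal.ofReal (A * t ^ (-(3 / 2 : ℝ))) :=
          setLIntegral_mono' measurableSet_Ioi fun t ht =>
            ENNReal.ofReal_le_ofReal (heatProfile_le_large r (ht₀0.trans ht))
      _ = ENNReal.ofReal (∫ t in Ioi t₀, A * t ^ (-(3 / 2 : ℝ))) :=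
          (ofReal_integral_eq_lintegral_ofReal hint hnn).symm
      _ = ENNReal.ofReal (A * (2 * Real.sqrt 8) * r⁻¹) := by
          refine le_antisymm (ENNReal.ofReal_le_ofReal (le_of_eq ?_))
            (ENNReal.ofReal_le_ofReal (le_of_eq ?_)) <;>
          [skip; symm] <;>
          · rw [MeasureTheory.integral_const_mul, integral_Ioi_rpow_of_lt (by norm_num) ht₀0]
            have h1 : t₀ ^ (-(3 / 2 : ℝ) + 1) = (Real.sqrt t₀)⁻¹ := by
              rw [Real.sqrt_eq_rpow, ← Real.rpow_neg ht₀0.le]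
              norm_num
            rw [h1, hsqt₀, inv_div]
            field_simp
            nlinarith [hs88]
  -- assemble
  have hunion : Ioi (0 : ℝ) = Ioc 0 t₀ ∪ Ioi t₀ := (Ioc_union_Ioi_eq_Ioi ht₀0.le).symm
  calc ∫⁻ t in Ioi (0 : ℝ), ENNReal.ofReal
        ((Real.sqrt (8 * Real.pi * t))⁻¹ ^ 3 * Real.exp (-r ^ 2 / (8 * t)))
      ≤ (∫⁻ t in Ioc 0 t₀, ENNReal.ofReal
          ((Real.sqrt (8 * Real.pi * t))⁻¹ ^ 3 * Real.exp (-r ^ 2 / (8 * t)))) +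
        ∫⁻ t in Ioi t₀, ENNReal.ofReal
          ((Real.sqrt (8 * Real.pi * t))⁻¹ ^ 3 * Real.exp (-r ^ 2 / (8 * t))) := by
        rw [hunion]
        exact lintegral_union_le _ _ _
    _ ≤ ENNReal.ofReal (A * (2 * Real.sqrt 8) * r⁻¹) +
        ENNReal.ofReal (A * (2 * Real.sqrt 8) * r⁻¹) := add_le_add hsmall hlarge
    _ = ENNReal.ofReal (4 * Real.sqrt 8 / Real.sqrt (8 * Real.pi) ^ 3 * r⁻¹) := by
        rw [← ENNReal.ofReal_add (by positivity) (by positivity)]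
        congr 1
        rw [hA]
        field_simp
        ring

/-! ### Numerical constants -/

/-- `√(8π)³ ≤ 127` (`π < 3.15`). [folklore] -/
theorem sqrt_eight_pi_pow_three_le : Real.sqrt (8 * Real.pi) ^ 3 ≤ 127 := by
  have hπ : Real.pi < 3.15 := Real.pi_lt_d2
  have hs : Real.sqrt (8 * Real.pi) ≤ 5.02 := by
    rw [Real.sqrt_le_left (by norm_num)]
    nlinarith
  calc Real.sqrt (8 * Real.pi) ^ 3 ≤ (5.02 : ℝ) ^ 3 :=
        pow_le_pow_left₀ (Real.sqrt_nonneg _) hs 3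
    _ ≤ 127 := by norm_num

/-- **The constants of the occupation estimate**: with `c₃ = e^{-1/4}/(2√(8π)³)` (Green lower
bound) and `C₃ = 4√8/√(8π)³` (Green upper bound), `c₃ ≥ 2/1000` and `C₃ ≤ 125 c₃`
(`e^{-1/4} ≥ 3/4`, `√8 ≤ 3`, `√(8π)³ ≤ 127`). [folklore] -/
theorem green_consts :
    2 / 1000 ≤ Real.exp (-(1 / 4 : ℝ)) / (2 * Real.sqrt (8 * Real.pi) ^ 3) ∧
      4 * Real.sqrt 8 / Real.sqrt (8 * Real.pi) ^ 3 ≤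
        125 * (Real.exp (-(1 / 4 : ℝ)) / (2 * Real.sqrt (8 * Real.pi) ^ 3)) := by
  have he : 3 / 4 ≤ Real.exp (-(1 / 4 : ℝ)) := by
    have h := Real.add_one_le_exp (-(1 / 4 : ℝ))
    linarith
  have hD : 0 < Real.sqrt (8 * Real.pi) ^ 3 := pow_pos (Real.sqrt_pos.2 (by positivity)) 3
  have hD' := sqrt_eight_pi_pow_three_le
  have hs8 : Real.sqrt 8 ≤ 3 := by
    rw [Real.sqrt_le_left (by norm_num)]
    norm_num
  constructor
  · rw [le_div_iff₀ (by positivity)]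
    nlinarith
  · rw [mul_div_assoc', div_le_div_iff₀ hD (by positivity)]
    nlinarith [Real.sqrt_nonneg 8]

end Summit.AtomisticToContinuum.BoseEinsteinCondensation.Theorems.CutLineWitness

end
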